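import Literature.AlgebraicGeometry.Modules.StrictlyPerfectResolution
import Literature.AlgebraicGeometry.Modules.InvertibleModule
import Literature.AlgebraicGeometry.Modules.TensorProductLocallyFree
import Literature.AlgebraicGeometry.Modules.StrictlyPerfectResolutionExists
import Literature.AlgebraicGeometry.Motives.JacobianAbelJacobiTranslates
import Literature.AlgebraicGeometry.Modules.PushforwardIsoAdjunction
import Literature.AlgebraicGeometry.KTheory.PullbackVectorBundle
import Mathlib.CategoryTheory.Adjunction.Unique
import Mathlib.CategoryTheory.Adjunction.Limits
import Mathlib.Algebra.Homology.QuasiIso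
import HarnessLib

/-!
# Twisting a strictly perfect resolution by an invertible module; resolutions of twisted Abel–Jacobi translate ideals

Layer `Literature/AlgebraicGeometry/Modules` (+ a Jacobian specialisation, §2); namespaces follow the layers. ONE construction (`def`, data — like
`StrictlyPerfectResolution.cone` of `KTheory/CoherentEulerCharacteristic`) and theorems; no named fact, no instance, no notation.

For a scheme `X`, an `𝒪_X`-module `G` with a strictly perfect resolution `R` (`Modules/StrictlyPerfectResolution`: a bounded complex `R.P` of finite
locally free modules in degrees `≤ 0` with a quasi-isomorphism `R.ε : R.P ⟶ G[0]`) and a finite locally free `N` which is INVERTIBLE (`IsInvertibleModule N`: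
`N ⊗ –` is an equivalence of `Mod(𝒪_X)`, The Stacks Project Def. 17.25.1 Tag 01CS — e.g. every `N` of rank one, Lemma 17.25.4 Tag 0B8M, the tree's named fact
`LocallyFreeRankOneIsInvertible`), the TWISTED complex `N ⊗ R.P` with the twisted augmentation is a strictly perfect resolution of `N ⊗ G`
(`StrictlyPerfectResolution.twist`): its terms `N ⊗ Pⁱ` are finite locally free (Stacks 01CE (7), the tree's `isFiniteLocallyFree_tensorObj`), zero where `Pⁱ` is,
and `N ⊗ –`, being an equivalence, is exact, so it carries the quasi-isomorphism `ε` to a quasi-isomorphism (Mathlib `quasiIso_map_of_preservesHomology`).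
Hartshorne III Prop. 6.7 ∕ Ex. 6.5 context: «tensoring with a locally free sheaf of finite rank is exact» — here obtained from invertibility.

* §1 `StrictlyPerfectResolution.twist hN hInv R : StrictlyPerfectResolution (tensorObj N G)`, `twist_P` (`rfl`), `nonempty_twist`, and the rank-one form under the
  named fact, `nonempty_twist_of_hasRank_one`.
* §2 on an abelian variety ∕ a Jacobian over a field: `AbelianVariety.nonempty_strictlyPerfectResolution_tensorObj` (any coherent `G`, any rank-one f.l.f. `P`) and
  **`Jacobian.nonempty_strictlyPerfectResolution_tensorObj_ajTranslatesIdeal`** — the twisted ideal `P ⊗ 𝓘_𝒵` of the Abel–Jacobi translates `𝒵 = ⋃_{s ∈ S} (W₁ + s)`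
  has a strictly perfect resolution — under the two displayed named facts `Hartshorne1977_exists_strictlyPerfectResolution` (III Ex. 6.9) and `LocallyFreeRankOneIsInvertible`
  (Stacks 0B8M), next to (M2)'s `Jacobian.nonempty_strictlyPerfectResolution_ajTranslatesIdeal'`.
* §3 pull-back of a resolution along an ISOMORPHISM of schemes (`StrictlyPerfectResolution.pullbackIso`; `isEquivalence_pullback_hom`) and the translate of a resolved
  module on an abelian variety (`AbelianVariety.nonempty_strictlyPerfectResolution_pullback_translation`).
* §4 (APPEND) the primed UNCONDITIONAL rank-one forms (0B8M = the tree theorem `LocallyFreeRankOneIsInvertible_holds`).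

Use (Hodge programme, road №4, crux 26512, route «2T»): the resolution DATA `Rᵢ•, Sᵢ•` of the socket `oneNonJumpingPoint_of_inputs_fullyFaithful`
(`Theorems/VHCAbelianSchemesRoadOneNonJumpingPointOfInputs` §5) exist at a Jacobian for print's factors `I_{𝒵_C} ⊗ P_α`, `I_{𝒵_C}` (and the twisted `𝒵_Σ`-ideals);
library only — proves nothing about (N-U), 26512, №4, HC_AV or HC.

## References

* R. Hartshorne, *Algebraic Geometry* (1977), III Prop. 6.7, Ex. 6.5, Ex. 6.9 (p. 238). [Hartshorne1977]
* The Stacks Project, Tag 01CS (Definition 17.25.1), Tag 0B8M (Lemma 17.25.4), Tag 01CE (Lemma 17.16.6 (7)). [StacksProject]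
* C. A. Weibel, *An introduction to homological algebra* (1994), Def. 2.2.4, Exercise 2.2.3. [Weibel1994]
-/

noncomputable section

open CategoryTheory CategoryTheory.Limits AlgebraicGeometry

universe u

namespace Literature.AlgebraicGeometry.Modules

open Literature.AlgebraicGeometry.Motives Literature.AlgebraicGeometry.KTheory

variable {X : Scheme.{u}} {N G : X.Modules}

/-! ## §1 The twist `N ⊗ R` of a strictly perfect resolution -/

namespace StrictlyPerfectResolution

/-- **The twist of a strictly perfect resolution by an invertible finite locally free module**: `N ⊗ R.P` with the augmentation
`N ⊗ R.P ⟶ N ⊗ G[0] = (N ⊗ G)[0]` is a strictly perfect resolution of `N ⊗ G` (terms `N ⊗ Pⁱ` finite locally free, zero in positive degrees; `N ⊗ –` is an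
equivalence, hence exact, hence preserves the quasi-isomorphism `ε`). [cite: Hartshorne1977, III Prop. 6.7 and Ex. 6.5] [cite: StacksProject, Tag 01CS and Tag 01CE (7)] -/
def twist (hN : IsFiniteLocallyFree N) (hInv : IsInvertibleModule N) (R : StrictlyPerfectResolution G) :
    StrictlyPerfectResolution (tensorObj N G) :=
  haveI : ((tensorBifunctor X).obj N).Additive := additive_tensorBifunctor_obj N
  haveI := hInv.isEquivalence
  { P := (((tensorBifunctor X).obj N).mapHomologicalComplex (ComplexShape.up ℤ)).obj R.P
    isBoundedVB :=
      { isFiniteLocallyFree := fun i => isFiniteLocallyFree_tensorObj _ _ hN (R.isFiniteLocallyFree i)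
        exists_finset := by
          obtain ⟨s, hs⟩ := R.isBoundedVB.exists_finset
          exact ⟨s, fun i hi => isZero_tensorObj_of_isZero N _ (hs i hi)⟩ }
    isStrictlyLE := by
      rw [CochainComplex.isStrictlyLE_iff]
      intro i hi
      exact isZero_tensorObj_of_isZero N _ (R.isZero_X_of_pos hi)
    ε := (((tensorBifunctor X).obj N).mapHomologicalComplex (ComplexShape.up ℤ)).map R.ε ≫
      ((HomologicalComplex.singleMapHomologicalComplex ((tensorBifunctor X).obj N) (ComplexShape.up ℤ) 0).app G).hom
    quasiIso := by
      haveI := R.quasiIso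
      haveI : IsIso ((HomologicalComplex.singleMapHomologicalComplex ((tensorBifunctor X).obj N) (ComplexShape.up ℤ) 0).app G).hom :=
        inferInstance
      exact quasiIso_comp _ _ }

/-- The resolving complex of the twist is `N ⊗ R.P` termwise (`rfl`). [cite: Hartshorne1977, III Ex. 6.5] -/
theorem twist_P (hN : IsFiniteLocallyFree N) (hInv : IsInvertibleModule N) (R : StrictlyPerfectResolution G) :
    haveI : ((tensorBifunctor X).obj N).Additive := additive_tensorBifunctor_obj N
    (twist hN hInv R).P = (((tensorBifunctor X).obj N).mapHomologicalComplex (ComplexShape.up ℤ)).obj R.P := rfl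

/-- The terms of the twist are `N ⊗ Pⁱ` (`rfl`). [cite: Hartshorne1977, III Ex. 6.5] -/
theorem twist_P_X (hN : IsFiniteLocallyFree N) (hInv : IsInvertibleModule N) (R : StrictlyPerfectResolution G) (i : ℤ) :
    (twist hN hInv R).P.X i = tensorObj N (R.P.X i) := rfl

/-- **`N ⊗ G` has a strictly perfect resolution when `G` has one and `N` is invertible finite locally free.** [cite: Hartshorne1977, III Prop. 6.7 and Ex. 6.5] -/
theorem nonempty_twist (hN : IsFiniteLocallyFree N) (hInv : IsInvertibleModule N) (h : Nonempty (StrictlyPerfectResolution G)) :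
    Nonempty (StrictlyPerfectResolution (tensorObj N G)) :=
  ⟨twist hN hInv h.some⟩

/-- **The rank-one form under the named fact** `LocallyFreeRankOneIsInvertible` (Stacks 0B8M): for `N` finite locally free of rank one, `N ⊗ G` has a strictly perfect
resolution when `G` does. CONDITIONAL on the fact. [cite: StacksProject, Tag 0B8M (Modules, Lemma 17.25.4)] [cite: Hartshorne1977, III Ex. 6.5] -/
theorem nonempty_twist_of_hasRank_one (hfact : LocallyFreeRankOneIsInvertible.{u}) (hN : IsFiniteLocallyFree N) (h₁ : HasRank N 1)
    (h : Nonempty (StrictlyPerfectResolution G)) : Nonempty (StrictlyPerfectResolution (tensorObj N G)) :=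
  nonempty_twist hN (hfact N hN h₁) h

end StrictlyPerfectResolution

end Literature.AlgebraicGeometry.Modules

/-! ## §2 On an abelian variety ∕ a Jacobian: resolutions of twisted coherent sheaves and of twisted Abel–Jacobi translate ideals -/

namespace Literature.AlgebraicGeometry.Motives

open Literature.AlgebraicGeometry.Modules

namespace AbelianVariety

variable {K : Type u} [Field K] (A : AbelianVariety K)

/-- **Under Hartshorne III Ex. 6.9 and Stacks 0B8M, `P ⊗ G` has a strictly perfect resolution on an abelian variety** for `G` coherent and `P` finite locally free of
rank one (`AbelianVariety.nonempty_strictlyPerfectResolution` twisted). CONDITIONAL on the two named facts.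
[cite: Hartshorne1977, III Ex. 6.9 (a) (p. 238)] [cite: StacksProject, Tag 0B8M (Modules, Lemma 17.25.4)] -/
theorem nonempty_strictlyPerfectResolution_tensorObj (h : Hartshorne1977_exists_strictlyPerfectResolution.{u})
    (hInv : LocallyFreeRankOneIsInvertible.{u}) {P F : A.X.left.Modules} (hP : IsFiniteLocallyFree P) (h₁ : HasRank P 1) (hF : Morphisms.Coh F) :
    Nonempty (StrictlyPerfectResolution (tensorObj P F)) :=
  StrictlyPerfectResolution.nonempty_twist_of_hasRank_one hInv hP h₁ (A.nonempty_strictlyPerfectResolution h hF)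

end AbelianVariety

namespace Jacobian

variable {k : Type u} [Field k] {C : SchemeOver k} (𝒥 : Jacobian C)

/-- **The twisted Abel–Jacobi translate ideal `P ⊗ 𝓘_𝒵` has a strictly perfect resolution** (`𝒵 = ⋃_{s ∈ S} (W₁ + s)` the translates of the Abel–Jacobi curve in the
Jacobian, `P` finite locally free of rank one — print's `I_{𝒵_C} ⊗ P_α`), under Hartshorne III Ex. 6.9 and Stacks 0B8M by name ((M2)'s
`nonempty_strictlyPerfectResolution_ajTranslatesIdeal'`, twisted). [cite: Hartshorne1977, III Ex. 6.9 (a) (p. 238)] [cite: StacksProject, Tag 0B8M (Modules, Lemma 17.25.4)] -/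
theorem nonempty_strictlyPerfectResolution_tensorObj_ajTranslatesIdeal (h : Hartshorne1977_exists_strictlyPerfectResolution.{u})
    (hInv : LocallyFreeRankOneIsInvertible.{u}) {P : 𝒥.J.X.left.Modules} (hP : IsFiniteLocallyFree P) (h₁ : HasRank P 1)
    (P₀ : AlgPoints C k) (S : Finset (𝒥.J.Points k)) :
    Nonempty (StrictlyPerfectResolution (tensorObj P (𝒥.ajTranslatesIdeal P₀ S))) :=
  StrictlyPerfectResolution.nonempty_twist_of_hasRank_one hInv hP h₁ (𝒥.nonempty_strictlyPerfectResolution_ajTranslatesIdeal' h P₀ S)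

end Jacobian

end Literature.AlgebraicGeometry.Motives


/-! ## §3 Pull-back of a strictly perfect resolution along an isomorphism of schemes (e.g. a translation of an abelian variety) -/

namespace Literature.AlgebraicGeometry.Modules

open Literature.AlgebraicGeometry.Motives Literature.AlgebraicGeometry.KTheory

/-- Pull-back along an isomorphism of schemes is an equivalence of module categories (left adjoint of the equivalence `ε_*`,
`Modules.isEquivalence_pushforward_hom`; left adjoints are unique). The Literature home of the Summits-side helper
`Summit.HodgeConjecture.HodgeConjecture.Ring2.SemiregularRepresentatives.NowhereDisplaceable.isEquivalence_pullback_of_iso` (same statement; Literature cannot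
import Summits). [cite: Hartshorne1977, II §5 p. 110] -/
theorem isEquivalence_pullback_hom {Y₀ Y₁ : Scheme.{u}} (ε : Y₀ ≅ Y₁) : (Scheme.Modules.pullback ε.hom).IsEquivalence :=
  Functor.isEquivalence_of_iso
    ((Scheme.Modules.pushforward ε.hom).asEquivalence.symm.toAdjunction.leftAdjointUniq (Scheme.Modules.pullbackPushforwardAdjunction ε.hom))

namespace StrictlyPerfectResolution

variable {Y₀ Y₁ : Scheme.{u}} {G : Y₁.Modules}

/-- **Pull-back of a strictly perfect resolution along an isomorphism of schemes** `ε : Y₀ ≅ Y₁`: `ε^*R.P ⟶ ε^*G[0] = (ε^*G)[0]` is a strictly perfect resolution of `ε^*G`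
(pulled-back vector bundles, Stacks 01C8; `ε^*` is an equivalence, hence exact, hence preserves the quasi-isomorphism). [cite: Hartshorne1977, III Ex. 6.5] [cite: StacksProject, Tag 01C8] -/
def pullbackIso (ε : Y₀ ≅ Y₁) (R : StrictlyPerfectResolution G) : StrictlyPerfectResolution ((Scheme.Modules.pullback ε.hom).obj G) :=
  haveI := isEquivalence_pullback_hom ε
  { P := ((Scheme.Modules.pullback ε.hom).mapHomologicalComplex (ComplexShape.up ℤ)).obj R.P
    isBoundedVB := R.isBoundedVB.pullback ε.hom
    isStrictlyLE := by
      rw [CochainComplex.isStrictlyLE_iff]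
      intro i hi
      exact (Scheme.Modules.pullback ε.hom).map_isZero (R.isZero_X_of_pos hi)
    ε := ((Scheme.Modules.pullback ε.hom).mapHomologicalComplex (ComplexShape.up ℤ)).map R.ε ≫
      ((HomologicalComplex.singleMapHomologicalComplex (Scheme.Modules.pullback ε.hom) (ComplexShape.up ℤ) 0).app G).hom
    quasiIso := by
      haveI := R.quasiIso
      haveI : IsIso ((HomologicalComplex.singleMapHomologicalComplex (Scheme.Modules.pullback ε.hom) (ComplexShape.up ℤ) 0).app G).hom :=
        inferInstance
      exact quasiIso_comp _ _ }

/-- The resolving complex of the pull-back is `ε^*R.P` termwise (`rfl`). [cite: Hartshorne1977, III Ex. 6.5] -/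
theorem pullbackIso_P (ε : Y₀ ≅ Y₁) (R : StrictlyPerfectResolution G) :
    (pullbackIso ε R).P = ((Scheme.Modules.pullback ε.hom).mapHomologicalComplex (ComplexShape.up ℤ)).obj R.P := rfl

end StrictlyPerfectResolution

end Literature.AlgebraicGeometry.Modules

namespace Literature.AlgebraicGeometry.Motives.AbelianVariety

open Literature.AlgebraicGeometry.Modules

variable {K : Type u} [Field K] (A : AbelianVariety K)

/-- **The translate `t_x^*G` of a module with a strictly perfect resolution has one** (`t_x` is an automorphism of `A`: `translationIso`). For the route's socket: the
translated (twisted) Abel–Jacobi translate ideals are resolved once the untranslated ones are. [cite: Hartshorne1977, III Ex. 6.5] [cite: MumfordAV1970, §4 (p. 41, translations)] -/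
theorem nonempty_strictlyPerfectResolution_pullback_translation (x : A.Points K) {G : A.X.left.Modules} (h : Nonempty (StrictlyPerfectResolution G)) :
    Nonempty (StrictlyPerfectResolution ((Scheme.Modules.pullback (A.translation x).left).obj G)) :=
  ⟨StrictlyPerfectResolution.pullbackIso ((Over.forget _).mapIso (A.translationIso x)) h.some⟩

end Literature.AlgebraicGeometry.Motives.AbelianVariety


/-! ## §4 (APPEND, same seat) UNCONDITIONAL rank-one forms — Stacks 0B8M is the tree theorem `LocallyFreeRankOneIsInvertible_holds` (`Modules/InvertibleModule`,
`Modules/InvertibleOfRankOne`): the `hInv ∕ hfact` hypotheses of §§1–2 are discharged; only Hartshorne III Ex. 6.9 remains where existence of resolutions is used. -/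

namespace Literature.AlgebraicGeometry.Modules.StrictlyPerfectResolution

open Literature.AlgebraicGeometry.Motives

variable {X : Scheme.{u}} {N G : X.Modules}

/-- **`N ⊗ G` has a strictly perfect resolution when `G` does, for EVERY finite locally free `N` of rank one** — no named fact (0B8M is
`LocallyFreeRankOneIsInvertible_holds`). [cite: StacksProject, Tag 0B8M (Modules, Lemma 17.25.4)] [cite: Hartshorne1977, III Ex. 6.5] -/
theorem nonempty_twist_of_hasRank_one' (hN : IsFiniteLocallyFree N) (h₁ : HasRank N 1) (h : Nonempty (StrictlyPerfectResolution G)) :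
    Nonempty (StrictlyPerfectResolution (tensorObj N G)) :=
  nonempty_twist_of_hasRank_one LocallyFreeRankOneIsInvertible_holds hN h₁ h

end Literature.AlgebraicGeometry.Modules.StrictlyPerfectResolution

namespace Literature.AlgebraicGeometry.Motives

open Literature.AlgebraicGeometry.Modules

/-- **Under Hartshorne III Ex. 6.9 ALONE, `P ⊗ F` has a strictly perfect resolution on an abelian variety** (`F` coherent, `P` finite locally free of rank one).
[cite: Hartshorne1977, III Ex. 6.9 (a) (p. 238)] [cite: StacksProject, Tag 0B8M (Modules, Lemma 17.25.4)] -/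
theorem AbelianVariety.nonempty_strictlyPerfectResolution_tensorObj' {K : Type u} [Field K] (A : AbelianVariety K)
    (h : Hartshorne1977_exists_strictlyPerfectResolution.{u}) {P F : A.X.left.Modules} (hP : IsFiniteLocallyFree P) (h₁ : HasRank P 1) (hF : Morphisms.Coh F) :
    Nonempty (StrictlyPerfectResolution (tensorObj P F)) :=
  A.nonempty_strictlyPerfectResolution_tensorObj h LocallyFreeRankOneIsInvertible_holds hP h₁ hF

/-- **Under Hartshorne III Ex. 6.9 ALONE, the twisted Abel–Jacobi translate ideal `P ⊗ 𝓘_𝒵` has a strictly perfect resolution** (print's `I_{𝒵_C} ⊗ P_α`).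
[cite: Hartshorne1977, III Ex. 6.9 (a) (p. 238)] [cite: StacksProject, Tag 0B8M (Modules, Lemma 17.25.4)] -/
theorem Jacobian.nonempty_strictlyPerfectResolution_tensorObj_ajTranslatesIdeal' {k : Type u} [Field k] {C : SchemeOver k} (𝒥 : Jacobian C)
    (h : Hartshorne1977_exists_strictlyPerfectResolution.{u}) {P : 𝒥.J.X.left.Modules} (hP : IsFiniteLocallyFree P) (h₁ : HasRank P 1)
    (P₀ : AlgPoints C k) (S : Finset (𝒥.J.Points k)) :
    Nonempty (StrictlyPerfectResolution (tensorObj P (𝒥.ajTranslatesIdeal P₀ S))) :=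
  𝒥.nonempty_strictlyPerfectResolution_tensorObj_ajTranslatesIdeal h LocallyFreeRankOneIsInvertible_holds hP h₁ P₀ S

end Literature.AlgebraicGeometry.Motives

end
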